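import Literature.Analysis.FluidPDE.CollisionWeakForm
import HarnessLib

/-!
# Hilbert's sixth problem, wave 0: the weak formulation and the `H`-theorem inequality for hard spheres (proofs)

Topic: MathematicalPhysics / KineticTheory. Discharge of three named facts of
`Literature/MathematicalPhysics/KineticTheory/Hilbert6Wave0` (**hilbert6.S09**, **hilbert6.S12**)
for the hard-sphere collision operator `collisionOp` (kernel `((v - v_*)·ω)_+`), as special cases
of the general weak formulation of `Literature/Analysis/FluidPDE/CollisionWeakForm` (the
hard-sphere kernel has the two micro-reversibility symmetries,
`isGradCutoffKernel_hardSphereKernel`):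

* `integral_collisionOp_mul_holds` (CIP 1994 (3.1.7)–(3.1.9)):
  `∫ Q(f,f) φ dv = ¼ ∫∫∫ ((v - v_*)·ω)_+ (f'f_*' - f f_*)(φ + φ_* - φ' - φ_*')`;
* `integral_collisionOp_mul_eq_zero_holds` (CIP 1994 §3.1 Cor.): `∫ Q(f,f) φ dv = 0` for
  collision invariants;
* `integral_collisionOp_mul_log_nonpos_holds` (Boltzmann's `H`-theorem, inequality; CIP 1994
  §3.2–3.3): `∫ Q(f,f) log f dv = -D(f) ≤ 0` for `f > 0`.

(The equality case `integral_collisionOp_mul_log_eq_zero_iff` — vanishing entropy production iff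
`f` is a Maxwellian — additionally needs the passage from `D(f) = 0` to the pointwise functional
equation `f'f_*' = f f_*`, i.e. full support of the sphere measure; it is not treated here.)

Also recorded, in the `Literature.Analysis.FluidPDE` namespace of its statement:
`entropyProduction_eq_neg_integral_collisionOp_mul_log_holds`, the `H`-theorem identity
`D_B(h) = -∫ Q_B(h,h) log h dv` for Grad cut-off kernels
(`Literature/Analysis/FluidPDE/BoltzmannEquation`).

## References

* C. Cercignani, R. Illner, M. Pulvirenti, *The Mathematical Theory of Dilute Gases*, Springer
  (1994), §3.1 (3.1.7)–(3.1.9) and Cor. after (3.1.9); §3.2 (3.2.4)–(3.2.6); §3.3.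
* C. Villani, *A review of mathematical topics in collisional kinetic theory* (2002), Ch. 1
  §2.3 (40), §2.4.
-/

open MeasureTheory Metric Real Set Filter Topology
open scoped InnerProductSpace ENNReal

noncomputable section

/-! ## The `H`-theorem identity for Grad cut-off kernels -/

namespace Literature.Analysis.FluidPDE

variable {E : Type*} [NormedAddCommGroup E] [InnerProductSpace ℝ E] [FiniteDimensional ℝ E]
  [MeasurableSpace E] [BorelSpace E]

/-- **Discharge of `entropyProduction_eq_neg_integral_collisionOp_mul_log`** (CIP 1994 §3.2
(3.2.4)–(3.2.6); Villani 2002 Ch. 1 §2.4): for a Grad cut-off (micro-reversible) kernel `B`,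
`h > 0` and an integrable weak integrand `B (h'h_*' - h h_*) log h(v)`,
`D_B(h) = -∫ Q_B(h, h)(v) log h(v) dv` — the case `a = 0` of
`integral_collisionOpWith_mul_const_add_log_eq`. [cite: CIPDiluteGases1994, §3.2 (3.2.4)–(3.2.6)] -/
theorem entropyProduction_eq_neg_integral_collisionOp_mul_log_holds :
    entropyProduction_eq_neg_integral_collisionOp_mul_log (E := E) := by
  intro B hB h hpos hint
  have key := integral_collisionOpWith_mul_const_add_log_eq hB.collide_neg hB.swap_neg hpos 0
    (by simpa only [zero_add] using hint)
  simp only [zero_add] at key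
  rw [key, neg_neg]

end Literature.Analysis.FluidPDE

/-! ## Hard spheres: weak formulation, collision invariants, `H`-theorem inequality -/

namespace Literature.MathematicalPhysics.KineticTheory

open Literature.Analysis.FluidPDE

variable {E : Type*} [NormedAddCommGroup E] [InnerProductSpace ℝ E] [FiniteDimensional ℝ E]
  [MeasurableSpace E] [BorelSpace E]

/-- Micro-reversibility of the hard-sphere kernel: `B(v', v_*', -ω) = B(v, v_*, ω)`. [folklore] -/
theorem hardSphereKernel_collide_neg (p : E × E) (ω : sphere (0 : E) 1) :
    hardSphereKernel (collide ω p) (-ω) = hardSphereKernel p ω :=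
  isGradCutoffKernel_hardSphereKernel.collide_neg p ω

/-- Exchange symmetry of the hard-sphere kernel: `B(v_*, v, -ω) = B(v, v_*, ω)`. [folklore] -/
theorem hardSphereKernel_swap_neg (p : E × E) (ω : sphere (0 : E) 1) :
    hardSphereKernel p.swap (-ω) = hardSphereKernel p ω :=
  isGradCutoffKernel_hardSphereKernel.swap_neg p ω

/-- **hilbert6.S09, discharge of `integral_collisionOp_mul`** (weak formulation of the hard-sphere
collision operator; CIP 1994 (3.1.7)–(3.1.9), Villani 2002 Ch. 1 §2.3 (40)):
`∫ Q(f,f) φ dv = ¼ ∫∫∫ ((v - v_*)·ω)_+ (f'f_*' - f f_*) (φ + φ_* - φ' - φ_*') dω dv_* dv` whenever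
the weak integrand is integrable. [cite: CIPDiluteGases1994, §3.1 (3.1.7)–(3.1.9)] -/
theorem integral_collisionOp_mul_holds : integral_collisionOp_mul (E := E) := by
  intro f φ hint
  have key := integral_collisionOpWith_mul_eq (B := hardSphereKernel (E := E))
    hardSphereKernel_collide_neg hardSphereKernel_swap_neg f φ
    (by simpa only [collisionIntegrand] using hint)
  rw [collisionOpWith_hardSphereKernel] at key
  rw [key]
  simp only [collisionIntegrand, one_div]

/-- **hilbert6.S09, discharge of `integral_collisionOp_mul_eq_zero`** (collision invariants
annihilate the hard-sphere collision operator: formal conservation of mass, momentum and energy;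
CIP 1994 §3.1 Cor. after (3.1.9)). [cite: CIPDiluteGases1994, §3.1 Cor. after (3.1.9)] -/
theorem integral_collisionOp_mul_eq_zero_holds : integral_collisionOp_mul_eq_zero (E := E) := by
  intro f φ hφ hint
  have key := integral_collisionOpWith_mul_eq_zero (B := hardSphereKernel (E := E))
    hardSphereKernel_collide_neg hardSphereKernel_swap_neg (g := f) hφ
    (by simpa only [collisionIntegrand] using hint)
  rwa [collisionOpWith_hardSphereKernel] at key

/-- **hilbert6.S12, discharge of `integral_collisionOp_mul_log_nonpos`** (Boltzmann's `H`-theorem,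
inequality; Boltzmann 1872; CIP 1994 §3.2–3.3; Villani 2002 Ch. 1 §2.4): for `f > 0` with an
integrable weak integrand, `∫ Q(f,f)(v) log f(v) dv = -D(f) ≤ 0`, the entropy production `D(f)`
of the hard-sphere kernel being nonnegative (`entropyProduction_nonneg`). [cite: CIPDiluteGases1994, §3.2–3.3] -/
theorem integral_collisionOp_mul_log_nonpos_holds : integral_collisionOp_mul_log_nonpos (E := E) := by
  intro f hpos hint
  have key := integral_collisionOpWith_mul_const_add_log_eq (B := hardSphereKernel (E := E))
    hardSphereKernel_collide_neg hardSphereKernel_swap_neg hpos 0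
    (by simpa only [collisionIntegrand, zero_add] using hint)
  simp only [zero_add, collisionOpWith_hardSphereKernel] at key
  rw [key, neg_nonpos]
  exact entropyProduction_nonneg (fun p ω => le_max_right _ _) hpos

end Literature.MathematicalPhysics.KineticTheory
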